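import Mathlib

/-!
# The first anisotropic order is rigid: radial `⟨BB⟩` for a degree-4 Wick bilinear forces isotropy
# (certified instance of the Borchers-class no-go, crux `PencilRigidity.NPointIsotropy`, stmt-QuantumFields-11686)

Negative-side support file (standing disprover, cycle 3). Context: the regular model-blind core behind the picked line
`complex-rotation-bandlimit` (`stub_harmonicKill`) would be refuted by a `W(B₄)`-scalar local Wick polynomial `s` in
free fields with RADIAL two-point function and an anisotropic higher Schwinger function. The disprover's Borchers-class
no-go theorem (`Cruxes/NPointIsotropy/Disproof.lean` §11) says no such `s` exists at any order: radiality of `⟨ss⟩`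
forces every on-shell symbol to be Lorentz/`SO(4)`-invariant, the mechanism being that the TOP boost-weight (= top
spherical-harmonic) component of a square is a non-negative, indeed definite, quantity. This file certifies that
mechanism at the first order where anisotropy can occur at all.

SETTING (massless free field `ψ` on `ℝ⁴`, `G = 1/x²`; exact computation over `ℚ`, kit job `j013980`, script
`compute/order4_radial.py` attached as item evidence). The `W(B₄)`-invariant Wick bilinears of total derivative order 4,
symmetric in the two factors, form a 7-dimensional space with momentum symbols
`M = a₁ S₄ + a₂ S₃₁ + a₃ S₂₂ + b₁ P₄ + b₂ P₂PQ + b₃ P₂Q₂ + b₄ (p·q)²`, where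
`S₄ = Σ_μ p_μ⁴ + q_μ⁴`, `S₃₁ = Σ_μ p_μ³q_μ + p_μq_μ³`, `S₂₂ = Σ_μ p_μ²q_μ²` are the three symbols that are NOT functions of
`p·q` on the massless shell `p² = q² = 0` (the anisotropic ones), `P₄ = (p²)² + (q²)²`, `P₂PQ = (p² + q²)(p·q)`,
`P₂Q₂ = p²q²` are null on shell, and `(p·q)²` is the isotropic non-null symbol. The two-point function is
`⟨B(x)B(0)⟩ = P(x)/|x|²⁰` with `P` homogeneous of degree 8 and quadratic in the coefficients; `⟨BB⟩` is radial off the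
origin iff the `W(B₄)`-invariant harmonic components of `P` of degrees 4, 6, 8 vanish (degree 2 vanishes identically;
`dim ℋ₈^{W(B₄)} = 2` but only one combination occurs). The computation returns exactly THREE independent quadrics:

* degree 8 (top):   `Q₈ = 142 a₁² + 40 a₁a₂ + 10 a₁a₃ + 7 a₂² + 5 a₂a₃ + a₃²`,
* degree 6:         `Q₆ = 12 a₁² + 48 a₁a₂ + 20 a₁a₃ + 3 a₂² + 2 a₂a₃`,
* degree 4:         `Q₄ = 192 a₁² + 144 a₁a₂ + 848 a₁a₃ + 2352 a₁b₄ + 21 a₂² + 200 a₂a₃ + 588 a₂b₄ + 68 a₃² + 196 a₃b₄`.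

The null coefficients `b₁, b₂, b₃` do not occur at all (null fields have vanishing correlations off the origin), `b₄`
occurs only in the lowest harmonic, and all three quadrics vanish on `{a₁ = a₂ = a₃ = 0}`. What is certified below
(pure real algebra, sorry-free):
* `topHarmonic_eq_sum_sq`: `Q₈ = (a₃ + 5/2 a₂ + 5 a₁)² + 3/4 (a₂ + 10 a₁)² + 42 a₁²` — the top harmonic is a POSITIVE
  DEFINITE form in the anisotropic coefficients (the "top weight of a square", `Disproof.lean` §11 step (3));
* `topHarmonic_eq_zero_iff`: `Q₈ = 0 ↔ a₁ = a₂ = a₃ = 0` — the top harmonic ALONE forces isotropy;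
* `radialQuadrics_iff`: the full radiality system `Q₄ = Q₆ = Q₈ = 0` is equivalent to `a₁ = a₂ = a₃ = 0`, for every
  value of the isotropic coefficient `b₄` (and trivially of `b₁, b₂, b₃`): a real `W(B₄)`-scalar order-4 Wick bilinear
  with radial two-point function is isotropic modulo null fields — the cycle-2 numerical finding ("7 unknowns, 3 quadrics,
  no real solution") as a kernel-checked statement;
* `lowerHarmonics_not_rigid`: the two LOWER harmonics can be tuned away by a genuinely anisotropic real bilinear —
  `(a₁,a₂,a₃,b₄) = (0, 2, −3, 6/7)` kills `Q₄` and `Q₆` but has `Q₈ = 7 ≠ 0` — so the rigidity sits exactly in the top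
  component, as the theorem predicts, and the complex solution branches found in cycle 2 (where positivity is void) are no
  accident: over `ℂ` the definite form `Q₈` has isotropic vectors.
-/

namespace Summit.QuantumFields.YangMills.Theorems.NPointIsotropy.Negative.RadialBilinearOrderFour

/-- **The top harmonic is a sum of squares** (positive definite in the anisotropic coefficients). -/
theorem topHarmonic_eq_sum_sq (a₁ a₂ a₃ : ℝ) :
    142 * a₁ ^ 2 + 40 * a₁ * a₂ + 10 * a₁ * a₃ + 7 * a₂ ^ 2 + 5 * a₂ * a₃ + a₃ ^ 2 =
      (a₃ + 5 / 2 * a₂ + 5 * a₁) ^ 2 + 3 / 4 * (a₂ + 10 * a₁) ^ 2 + 42 * a₁ ^ 2 := by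
  ring

/-- The top harmonic is non-negative … -/
theorem topHarmonic_nonneg (a₁ a₂ a₃ : ℝ) :
    0 ≤ 142 * a₁ ^ 2 + 40 * a₁ * a₂ + 10 * a₁ * a₃ + 7 * a₂ ^ 2 + 5 * a₂ * a₃ + a₃ ^ 2 := by
  rw [topHarmonic_eq_sum_sq]
  positivity

/-- **… and vanishes only at the isotropic point**: `Q₈ = 0 ↔ a₁ = a₂ = a₃ = 0`. -/
theorem topHarmonic_eq_zero_iff (a₁ a₂ a₃ : ℝ) :
    142 * a₁ ^ 2 + 40 * a₁ * a₂ + 10 * a₁ * a₃ + 7 * a₂ ^ 2 + 5 * a₂ * a₃ + a₃ ^ 2 = 0 ↔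
      a₁ = 0 ∧ a₂ = 0 ∧ a₃ = 0 := by
  constructor
  · intro h
    rw [topHarmonic_eq_sum_sq] at h
    have s1 := sq_nonneg (a₃ + 5 / 2 * a₂ + 5 * a₁)
    have s2 := sq_nonneg (a₂ + 10 * a₁)
    have s3 := sq_nonneg a₁
    have h1 : a₁ ^ 2 = 0 := by nlinarith
    have ha₁ : a₁ = 0 := pow_eq_zero_iff two_ne_zero |>.1 h1
    subst ha₁
    have h2 : (a₂ + 10 * 0) ^ 2 = 0 := by nlinarith
    have ha₂ : a₂ = 0 := by
      have := pow_eq_zero_iff two_ne_zero |>.1 h2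
      linarith
    subst ha₂
    have h3 : (a₃ + 5 / 2 * 0 + 5 * 0) ^ 2 = 0 := by nlinarith
    have ha₃ : a₃ = 0 := by
      have := pow_eq_zero_iff two_ne_zero |>.1 h3
      linarith
    exact ⟨rfl, rfl, ha₃⟩
  · rintro ⟨rfl, rfl, rfl⟩
    ring

/-- **Radial ⟺ isotropic at derivative order 4.** The three radiality quadrics (harmonic components of degrees 4, 6, 8
of the numerator of `⟨BB⟩`, kit job `j013980`) vanish simultaneously iff the three on-shell-anisotropic coefficients
vanish — for every value of the isotropic non-null coefficient `b₄` (the null coefficients `b₁, b₂, b₃` do not occur). -/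
theorem radialQuadrics_iff (a₁ a₂ a₃ b₄ : ℝ) :
    (192 * a₁ ^ 2 + 144 * a₁ * a₂ + 848 * a₁ * a₃ + 2352 * a₁ * b₄ + 21 * a₂ ^ 2 + 200 * a₂ * a₃ +
          588 * a₂ * b₄ + 68 * a₃ ^ 2 + 196 * a₃ * b₄ = 0 ∧
      12 * a₁ ^ 2 + 48 * a₁ * a₂ + 20 * a₁ * a₃ + 3 * a₂ ^ 2 + 2 * a₂ * a₃ = 0 ∧
      142 * a₁ ^ 2 + 40 * a₁ * a₂ + 10 * a₁ * a₃ + 7 * a₂ ^ 2 + 5 * a₂ * a₃ + a₃ ^ 2 = 0) ↔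
      a₁ = 0 ∧ a₂ = 0 ∧ a₃ = 0 := by
  constructor
  · rintro ⟨-, -, h8⟩
    exact (topHarmonic_eq_zero_iff a₁ a₂ a₃).1 h8
  · rintro ⟨rfl, rfl, rfl⟩
    refine ⟨?_, ?_, ?_⟩ <;> ring

/-- **The lower harmonics are NOT rigid**: the genuinely anisotropic real bilinear `(a₁,a₂,a₃,b₄) = (0, 2, -3, 6/7)`
(two units of `S₃₁`, minus three of `S₂₂`, `6/7` of `(p·q)²`) kills the degree-4 AND degree-6 components of `⟨BB⟩`, but
its top component is `Q₈ = 7 ≠ 0`. The rigidity is carried exactly by the top harmonic. -/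
theorem lowerHarmonics_not_rigid :
    ∃ a₁ a₂ a₃ b₄ : ℝ, a₂ ≠ 0 ∧
      192 * a₁ ^ 2 + 144 * a₁ * a₂ + 848 * a₁ * a₃ + 2352 * a₁ * b₄ + 21 * a₂ ^ 2 + 200 * a₂ * a₃ +
          588 * a₂ * b₄ + 68 * a₃ ^ 2 + 196 * a₃ * b₄ = 0 ∧
      12 * a₁ ^ 2 + 48 * a₁ * a₂ + 20 * a₁ * a₃ + 3 * a₂ ^ 2 + 2 * a₂ * a₃ = 0 ∧
      142 * a₁ ^ 2 + 40 * a₁ * a₂ + 10 * a₁ * a₃ + 7 * a₂ ^ 2 + 5 * a₂ * a₃ + a₃ ^ 2 = 7 :=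
  ⟨0, 2, -3, 6 / 7, two_ne_zero, by norm_num, by norm_num, by norm_num⟩

end Summit.QuantumFields.YangMills.Theorems.NPointIsotropy.Negative.RadialBilinearOrderFour
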